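import Mathlib
import Summits.AnomalousDissipation.AnomalousDissipation.Theorems.SolenoidalFractalHomogenisationLagrangianStepW7ChainGeometry
import Summits.AnomalousDissipation.AnomalousDissipation.Theorems.SolenoidalFractalHomogenisationLagrangianStepW7DrainFloorR
import Summits.AnomalousDissipation.AnomalousDissipation.Theorems.SolenoidalFractalHomogenisationLagrangianStepW7ThreeModeFibreR
import HarnessLib

/-!
# K1L_D (stmt-AnomalousDissipation-27980), (ℓ3) (D-TH)₀ «frozen-frame W7» — THE TWISTED CHAIN GEOMETRY: window numbers, drain floor and its bounds at the
# twisted chain `G₀ᵀ(K₀ + j·n·m)` (helper; `--supports stmt-AnomalousDissipation-27980 --as helper`)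

Port of `…W7ChainGeometry` §3 and of `W7Cell.chain_window_numbers` (`…W7Assembly` §1) to the FROZEN FRAME (prover ad-sawtooth-k1loc-p1 g16; memo
`HOME/ad-sawtooth-k1loc-p1/g16/DTH-costline-k1locp1g16.md` §2; RULING D28-19 (2)).  In a constant unimodular frame `G₀` with `|G₀ − 1| ≤ θ` entrywise the slow chain
`K₀ + j·K_s` (`K_s = n·m_s`) is tested along the TWISTED real wave vectors `q_j = twistFreq G₀ (K₀ + j·K_s) = q₀ + j·q_s`; the link constant `c` of the covering slot
is UNCHANGED (the drift is inserted verbatim: `W7Cell.c_chain_bounds` reused by name), while the window numbers and the drain floor move inside their slack: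
* §1 `twistFreq_sub`, `twistFreq_chain` — `twistFreq G₀ (K₀ + j•K_s) = twistFreq G₀ K₀ + j • twistFreq G₀ K_s`;
* §2 **`chain_window_numbersR`** — the six window inequalities of the slot step at the twisted chain, with `lo ↦ (1 − 3θ)²·lo`, `hiΛ + β/2 ↦ (1 + 3θ)²·(hiΛ + β/2)`
  (`ThreeMode.le_freqNormSq_twist` / `freqNormSq_twist_le` on top of the flat `W7Cell.freqNormSq_chain_ge/_le`), `0 ≤ θ ≤ 1/3`;
* §3 `dot_twist_sub_sq_le` — `(q₀·q_s − K₀·K_s)² ≤ 61θ²|K₀|²|K_s|²` (`θ ≤ 1/6`); **`q_chain_boundsR`** — the twisted drain coefficient satisfies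
  `γ/304 ≤ q_θ ≤ 2` on the covering slot (`(K₀·m)² ≥ (γ/6)‖K₀‖²`, `|m|² ≤ 3`, `2‖K₀‖ < n`) provided `4392·θ² ≤ γ` and `θ ≤ 1/6`;
* §4 **`hqw_chainR`** — `q_θ‖z‖² ≤ ‖P_{q₊} z‖² + ‖P_{q₋} z‖²` for `z ⊥ q₀` (= `W7Slot.drain_floor_pairR` in the chain's index shapes; the `hqw` of `slot_stepR`).
No definitions, no sorry.  NOT a proof of any block, of `stub_W7thg`, of K1L_D or of AD; rung F-D1.A0.
[cite: BedrossianCotiZelati2017, §2 (hypocoercivity functional)] [problem: turb]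
-/

set_option linter.dupNamespace false

namespace Summit.AnomalousDissipation.AnomalousDissipation.Theorems.SolenoidalFractalHomogenisation.LagrangianStep.W7Cell

open scoped InnerProductSpace
open Literature.Analysis Literature.Analysis.FunctionSpaces Literature.Analysis.FunctionSpaces.Torus
open Literature.Analysis.FluidPDE Literature.Analysis.FluidPDE.Torus
open Summit.AnomalousDissipation.AnomalousDissipation.Theorems
open Summit.AnomalousDissipation.AnomalousDissipation.Theorems.SolenoidalFractalHomogenisation.LagrangianStep.W7Slot
open Summit.AnomalousDissipation.AnomalousDissipation.Theorems.SolenoidalFractalHomogenisation.LagrangianStep.ThreeMode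

/-! ## §1 The twisted chain is an arithmetic progression of real wave vectors -/

/-- The twisted frequency is subtractive in the mode. -/
theorem twistFreq_sub (G₀ : Matrix (Fin 3) (Fin 3) ℝ) (k k' : Fin 3 → ℤ) : twistFreq G₀ (k - k') = twistFreq G₀ k - twistFreq G₀ k' := by
  rw [sub_eq_add_neg, twistFreq_add, twistFreq_neg, ← sub_eq_add_neg]

/-- The twisted frequency is `ℤ`-homogeneous in the mode. -/
theorem twistFreq_zsmul (G₀ : Matrix (Fin 3) (Fin 3) ℝ) (j : ℤ) (k : Fin 3 → ℤ) : twistFreq G₀ (j • k) = (j : ℝ) • twistFreq G₀ k := by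
  funext b
  simp only [twistFreq_apply, Pi.smul_apply, smul_eq_mul, Int.cast_mul, Finset.mul_sum]
  exact Finset.sum_congr rfl fun a _ => by ring

/-- **The twisted chain**: `twistFreq G₀ (K₀ + j•K_s) = twistFreq G₀ K₀ + j • twistFreq G₀ K_s`. -/
theorem twistFreq_chain (G₀ : Matrix (Fin 3) (Fin 3) ℝ) (K0 Ks : Fin 3 → ℤ) (j : ℤ) :
    twistFreq G₀ (K0 + j • Ks) = twistFreq G₀ K0 + (j : ℝ) • twistFreq G₀ Ks := by
  rw [twistFreq_add, twistFreq_zsmul]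

/-! ## §2 The window numbers at the twisted chain -/

/-- **The window numbers of the near chain in the frozen frame.**  With `lo' = (1/n²)(νlo/Λ)`, `hi' = (1/n²)(νhiΛ)`, `β' = (1/n²)(νβ)`:
for `j ≠ 0`, `π²νlo(1−3θ)²/Λ ≤ 4π²·lo'·|G₀ᵀ(K₀ + jK_s)|²`; for `j = ±1`, `4π²(hi' + β'/2)·|G₀ᵀ(K₀ + jK_s)|² ≤ 25π²ν(hiΛ + β/2)(1+3θ)²`; and the two are ordered.
[cite: BedrossianCotiZelati2017, §2 (hypocoercivity functional)] -/
theorem chain_window_numbersR {K0 m : Fin 3 → ℤ} {n : ℕ} {ν lo hi Λ β θ : ℝ} {G₀ : Matrix (Fin 3) (Fin 3) ℝ}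
    (hn : 1 ≤ n) (hm : m ≠ 0) (hm3 : freqNormSq m ≤ 3) (hK0 : K0 ≠ 0) (h2 : 2 * ‖Torus.latticeVec K0‖ < n) (hν : 0 < ν) (hlo : 0 < lo) (hlo1 : lo ≤ 1)
    (hhi : 1 ≤ hi) (hΛ : 1 ≤ Λ) (hβ : 0 ≤ β) (hθ : 0 ≤ θ) (hθ3 : θ ≤ 1 / 3)
    (hG : ∀ i j, |G₀ i j - (1 : Matrix (Fin 3) (Fin 3) ℝ) i j| ≤ θ) :
    (∀ j : ℤ, j ≠ 0 → Real.pi ^ 2 * ν * ((1 - 3 * θ) ^ 2 * lo) / Λ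
        ≤ 4 * Real.pi ^ 2 * ((1 / (n:ℝ) ^ 2) * (ν * (lo / Λ))) * ∑ b, twistFreq G₀ (K0 + j • (fun i => m i * (n : ℤ))) b ^ 2) ∧
    (∀ j : ℤ, (j = 1 ∨ j = -1) →
        4 * Real.pi ^ 2 * ((1 / (n:ℝ) ^ 2) * (ν * (hi * Λ)) + (1 / (n:ℝ) ^ 2) * (ν * β) / 2)
          * ∑ b, twistFreq G₀ (K0 + j • (fun i => m i * (n : ℤ))) b ^ 2 ≤ 25 * Real.pi ^ 2 * ν * ((1 + 3 * θ) ^ 2 * (hi * Λ + β / 2))) ∧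
    Real.pi ^ 2 * ν * ((1 - 3 * θ) ^ 2 * lo) / Λ ≤ 25 * Real.pi ^ 2 * ν * ((1 + 3 * θ) ^ 2 * (hi * Λ + β / 2)) := by
  have hn0 : (0:ℝ) < n := by exact_mod_cast hn
  have hΛ0 : 0 < Λ := by linarith
  have hπ : 0 < Real.pi ^ 2 := by positivity
  have h13 : 0 ≤ 1 - 3 * θ := by linarith
  refine ⟨fun j hj => ?_, fun j hj => ?_, ?_⟩
  · have h := freqNormSq_chain_ge hn hm hK0 h2 hj
    have ht := le_freqNormSq_twist hθ hθ3 hG (K0 + j • (fun i => m i * (n : ℤ)))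
    have hsl : (1 - 3 * θ) ^ 2 * ((n:ℝ) ^ 2 / 4) ≤ ∑ b, twistFreq G₀ (K0 + j • (fun i => m i * (n : ℤ))) b ^ 2 :=
      (mul_le_mul_of_nonneg_left h (sq_nonneg _)).trans ht
    calc Real.pi ^ 2 * ν * ((1 - 3 * θ) ^ 2 * lo) / Λ
        = 4 * Real.pi ^ 2 * ((1 / (n:ℝ) ^ 2) * (ν * (lo / Λ))) * ((1 - 3 * θ) ^ 2 * ((n:ℝ) ^ 2 / 4)) := by field_simp
      _ ≤ 4 * Real.pi ^ 2 * ((1 / (n:ℝ) ^ 2) * (ν * (lo / Λ))) * ∑ b, twistFreq G₀ (K0 + j • (fun i => m i * (n : ℤ))) b ^ 2 :=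
          mul_le_mul_of_nonneg_left hsl (by positivity)
  · have h := freqNormSq_chain_le (K0 := K0) h2 hm3 hj
    have ht := freqNormSq_twist_le hθ hG (K0 + j • (fun i => m i * (n : ℤ)))
    have hsl : ∑ b, twistFreq G₀ (K0 + j • (fun i => m i * (n : ℤ))) b ^ 2 ≤ (1 + 3 * θ) ^ 2 * (25 / 4 * (n:ℝ) ^ 2) :=
      ht.trans (mul_le_mul_of_nonneg_left h (sq_nonneg _))
    have hhb : 0 ≤ hi * Λ + β / 2 := by nlinarith
    calc 4 * Real.pi ^ 2 * ((1 / (n:ℝ) ^ 2) * (ν * (hi * Λ)) + (1 / (n:ℝ) ^ 2) * (ν * β) / 2)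
          * ∑ b, twistFreq G₀ (K0 + j • (fun i => m i * (n : ℤ))) b ^ 2
        ≤ 4 * Real.pi ^ 2 * ((1 / (n:ℝ) ^ 2) * (ν * (hi * Λ)) + (1 / (n:ℝ) ^ 2) * (ν * β) / 2) * ((1 + 3 * θ) ^ 2 * (25 / 4 * (n:ℝ) ^ 2)) :=
          mul_le_mul_of_nonneg_left hsl (by positivity)
      _ = 25 * Real.pi ^ 2 * ν * ((1 + 3 * θ) ^ 2 * (hi * Λ + β / 2)) := by field_simp
  · have h1 : lo / Λ ≤ 1 := by rw [div_le_one hΛ0]; linarith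
    have h2' : (1:ℝ) ≤ hi * Λ + β / 2 := by nlinarith
    have hl : (1 - 3 * θ) ^ 2 ≤ 1 := by nlinarith
    have hu : (1:ℝ) ≤ (1 + 3 * θ) ^ 2 := by nlinarith
    have : Real.pi ^ 2 * ν * ((1 - 3 * θ) ^ 2 * lo) / Λ = Real.pi ^ 2 * ν * ((1 - 3 * θ) ^ 2 * (lo / Λ)) := by ring
    rw [this]
    have hA : (1 - 3 * θ) ^ 2 * (lo / Λ) ≤ 1 := by
      calc (1 - 3 * θ) ^ 2 * (lo / Λ) ≤ 1 * 1 := mul_le_mul hl h1 (div_nonneg hlo.le hΛ0.le) zero_le_one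
        _ = 1 := by ring
    have hB : (1:ℝ) ≤ (1 + 3 * θ) ^ 2 * (hi * Λ + β / 2) := by nlinarith
    nlinarith [mul_pos hπ hν]

/-! ## §3 The twisted drain coefficient on the covering slot -/

/-- **The twisted dot product of two modes is `O(θ)`-close to the flat one**: `(G₀ᵀK·G₀ᵀL − K·L)² ≤ 61·θ²·|K|²·|L|²` for `|G₀ − 1| ≤ θ ≤ 1/6` entrywise. -/
theorem dot_twist_sub_sq_le {G₀ : Matrix (Fin 3) (Fin 3) ℝ} {θ : ℝ} (hθ : 0 ≤ θ) (hθ6 : θ ≤ 1 / 6)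
    (hG : ∀ i j, |G₀ i j - (1 : Matrix (Fin 3) (Fin 3) ℝ) i j| ≤ θ) (K L : Fin 3 → ℤ) :
    (∑ b, twistFreq G₀ K b * twistFreq G₀ L b - ∑ i, (K i : ℝ) * L i) ^ 2 ≤ 61 * θ ^ 2 * freqNormSq K * freqNormSq L := by
  set dK : Fin 3 → ℝ := fun b => twistFreq G₀ K b - (K b : ℝ) with hdK
  set dL : Fin 3 → ℝ := fun b => twistFreq G₀ L b - (L b : ℝ) with hdL
  have hDK : ∑ b, dK b ^ 2 ≤ 9 * θ ^ 2 * freqNormSq K := sum_sq_twistFreq_sub_le hθ hG K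
  have hDL : ∑ b, dL b ^ 2 ≤ 9 * θ ^ 2 * freqNormSq L := sum_sq_twistFreq_sub_le hθ hG L
  have hNK : 0 ≤ freqNormSq K := freqNormSq_nonneg K
  have hNL : 0 ≤ freqNormSq L := freqNormSq_nonneg L
  -- the difference = K·dL + dK·L + dK·dL
  have hsplit : ∑ b, twistFreq G₀ K b * twistFreq G₀ L b - ∑ i, (K i : ℝ) * L i
      = ∑ b, (K b : ℝ) * dL b + ∑ b, dK b * (L b : ℝ) + ∑ b, dK b * dL b := by
    rw [← Finset.sum_add_distrib, ← Finset.sum_add_distrib, ← Finset.sum_sub_distrib]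
    exact Finset.sum_congr rfl fun b _ => by simp only [hdK, hdL]; ring
  have h1 : (∑ b, (K b : ℝ) * dL b) ^ 2 ≤ freqNormSq K * (9 * θ ^ 2 * freqNormSq L) := by
    have h := dotR_sq_le_sumSq_mul (fun b => (K b : ℝ)) dL
    have e : ∑ a, (fun b => (K b : ℝ)) a ^ 2 = freqNormSq K := by simp [freqNormSq]
    rw [e] at h
    exact h.trans (mul_le_mul_of_nonneg_left hDL hNK)
  have h2 : (∑ b, dK b * (L b : ℝ)) ^ 2 ≤ (9 * θ ^ 2 * freqNormSq K) * freqNormSq L := by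
    have h := dotR_sq_le_sumSq_mul dK (fun b => (L b : ℝ))
    have e : ∑ a, (fun b => (L b : ℝ)) a ^ 2 = freqNormSq L := by simp [freqNormSq]
    rw [e] at h
    exact h.trans (mul_le_mul_of_nonneg_right hDK hNL)
  have h3 : (∑ b, dK b * dL b) ^ 2 ≤ (9 * θ ^ 2 * freqNormSq K) * (9 * θ ^ 2 * freqNormSq L) := by
    have h := dotR_sq_le_sumSq_mul dK dL
    exact h.trans (mul_le_mul hDK hDL (Finset.sum_nonneg fun b _ => sq_nonneg _) (by positivity))
  -- `(x+y+z)² ≤ 3(x²+y²+z²)` and `81θ⁴ ≤ 81θ²/36`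
  have hθ2 : θ ^ 2 ≤ 1 / 36 := by nlinarith
  rw [hsplit]
  have hsum3 : ∀ x y z : ℝ, (x + y + z) ^ 2 ≤ 3 * (x ^ 2 + y ^ 2 + z ^ 2) := fun x y z => by
    nlinarith [sq_nonneg (x - y), sq_nonneg (y - z), sq_nonneg (x - z)]
  refine (hsum3 _ _ _).trans ?_
  have hP : 0 ≤ θ ^ 2 * freqNormSq K * freqNormSq L := by positivity
  nlinarith [h1, h2, h3, mul_le_mul_of_nonneg_right hθ2 hP]

/-- `(n·b + a)² ≤ 5n²` for `a = ‖K₀‖ < n/2` and `b = ‖m‖` with `|m|² ≤ 3` (the flat denominator bound, recorded). -/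
theorem chain_denominator_le {K0 m : Fin 3 → ℤ} {n : ℕ} (h2 : 2 * ‖Torus.latticeVec K0‖ < n) (hm3 : freqNormSq m ≤ 3) :
    ((n:ℝ) * ‖Torus.latticeVec m‖ + ‖Torus.latticeVec K0‖) ^ 2 ≤ 5 * (n:ℝ) ^ 2 := by
  have h5 := norm_add_half_sq_le hm3
  have hn0 : (0:ℝ) ≤ n := Nat.cast_nonneg n
  have hb0 : 0 ≤ ‖Torus.latticeVec m‖ := norm_nonneg _
  have h1 : (n:ℝ) * ‖Torus.latticeVec m‖ + ‖Torus.latticeVec K0‖ ≤ (n:ℝ) * (‖Torus.latticeVec m‖ + 1 / 2) := by nlinarith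
  have h1' : ((n:ℝ) * ‖Torus.latticeVec m‖ + ‖Torus.latticeVec K0‖) ^ 2 ≤ ((n:ℝ) * (‖Torus.latticeVec m‖ + 1 / 2)) ^ 2 :=
    pow_le_pow_left₀ (by positivity) h1 2
  rw [mul_pow] at h1'
  nlinarith [sq_nonneg (n:ℝ)]

/-- **Bounds of the TWISTED drain coefficient on the covering slot**: `γ/304 ≤ q_θ ≤ 2`, where `q_θ` is the coefficient of `drain_floor_pairR` at
`q₀ = G₀ᵀK₀`, `q_s = G₀ᵀ(n·m)`, from the coverage `(K₀·m)² ≥ (γ/6)‖K₀‖²`, `|m|² ≤ 3`, `2‖K₀‖ < n`, and the frame smallness `|G₀ − 1| ≤ θ ≤ 1/6`,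
`4392·θ² ≤ γ`, `det G₀ ≠ 0`-free (only `G₀ᵀK₀ ≠ 0`, which follows from the slack). [cite: BedrossianCotiZelati2017, §2 (hypocoercivity functional)] -/
theorem q_chain_boundsR {K0 m : Fin 3 → ℤ} {n : ℕ} {γ θ : ℝ} {G₀ : Matrix (Fin 3) (Fin 3) ℝ} (hK0 : K0 ≠ 0) (h2 : 2 * ‖Torus.latticeVec K0‖ < n)
    (hm3 : freqNormSq m ≤ 3) (hγ : 0 ≤ γ) (hθ : 0 ≤ θ) (hθ6 : θ ≤ 1 / 6) (hθγ : 4392 * θ ^ 2 ≤ γ)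
    (hG : ∀ i j, |G₀ i j - (1 : Matrix (Fin 3) (Fin 3) ℝ) i j| ≤ θ)
    (hcov : γ / 6 * ‖Torus.latticeVec K0‖ ^ 2 ≤ (∑ i, (K0 i : ℝ) * m i) ^ 2) :
    γ / 304 ≤ 2 - ((∑ a, twistFreq G₀ (fun i => m i * (n : ℤ)) a ^ 2)
          - (∑ i, twistFreq G₀ K0 i * twistFreq G₀ (fun i => m i * (n : ℤ)) i) ^ 2 / ∑ a, twistFreq G₀ K0 a ^ 2)
        * (1 / (∑ a, (twistFreq G₀ K0 + twistFreq G₀ (fun i => m i * (n : ℤ))) a ^ 2)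
          + 1 / (∑ a, (twistFreq G₀ K0 - twistFreq G₀ (fun i => m i * (n : ℤ))) a ^ 2)) ∧
      2 - ((∑ a, twistFreq G₀ (fun i => m i * (n : ℤ)) a ^ 2)
          - (∑ i, twistFreq G₀ K0 i * twistFreq G₀ (fun i => m i * (n : ℤ)) i) ^ 2 / ∑ a, twistFreq G₀ K0 a ^ 2)
        * (1 / (∑ a, (twistFreq G₀ K0 + twistFreq G₀ (fun i => m i * (n : ℤ))) a ^ 2)
          + 1 / (∑ a, (twistFreq G₀ K0 - twistFreq G₀ (fun i => m i * (n : ℤ))) a ^ 2)) ≤ 2 := by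
  set Ks : Fin 3 → ℤ := fun i => m i * (n : ℤ) with hKs
  set q0 : Fin 3 → ℝ := twistFreq G₀ K0 with hq0
  set qs : Fin 3 → ℝ := twistFreq G₀ Ks with hqs
  refine ⟨?_, drain_floor_coeffR_le_two q0 qs⟩
  -- sizes of the flat objects
  set F : ℝ := freqNormSq K0 with hF
  have hFpos : 0 < F := freqNormSq_pos_of_ne_zero' hK0
  have hFeq : ‖Torus.latticeVec K0‖ ^ 2 = F := Literature.Analysis.FunctionSpaces.Torus.norm_latticeVec_sq K0
  have hn0 : (0:ℝ) ≤ n := Nat.cast_nonneg n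
  have hnpos : (0:ℝ) < n := by
    have := norm_nonneg (Torus.latticeVec K0); linarith
  have hKsN : freqNormSq Ks = (n:ℝ) ^ 2 * freqNormSq m := by
    rw [← Literature.Analysis.FunctionSpaces.Torus.norm_latticeVec_sq, hKs, norm_cellFreq, mul_pow, Literature.Analysis.FunctionSpaces.Torus.norm_latticeVec_sq]
  have hKs3 : freqNormSq Ks ≤ 3 * (n:ℝ) ^ 2 := by
    rw [hKsN]
    calc (n:ℝ) ^ 2 * freqNormSq m ≤ (n:ℝ) ^ 2 * 3 := mul_le_mul_of_nonneg_left hm3 (sq_nonneg _)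
      _ = 3 * (n:ℝ) ^ 2 := by ring
  have hdotK : ∑ i, (K0 i : ℝ) * Ks i = (n:ℝ) * ∑ i, (K0 i : ℝ) * m i := by
    rw [Finset.mul_sum]; refine Finset.sum_congr rfl fun i _ => ?_
    simp only [hKs]; push_cast; ring
  -- (1) the twisted slow vector is nonzero and the twisted sizes
  have h13 : 0 ≤ 1 - 3 * θ := by linarith
  have hθ3 : θ ≤ 1 / 3 := by linarith
  have hq0lo : (1 - 3 * θ) ^ 2 * F ≤ ∑ a, q0 a ^ 2 := le_freqNormSq_twist hθ hθ3 hG K0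
  have hq0hi : ∑ a, q0 a ^ 2 ≤ (1 + 3 * θ) ^ 2 * F := freqNormSq_twist_le hθ hG K0
  have hqshi : ∑ a, qs a ^ 2 ≤ (1 + 3 * θ) ^ 2 * freqNormSq Ks := freqNormSq_twist_le hθ hG Ks
  have h13pos : 0 < 1 - 3 * θ := by linarith
  have hq0pos : 0 < ∑ a, q0 a ^ 2 := lt_of_lt_of_le (mul_pos (pow_pos h13pos 2) hFpos) hq0lo
  have hq0ne : q0 ≠ 0 := fun h => by rw [h] at hq0pos; simp at hq0pos
  -- (2) the twisted dot is at least half the flat one in square: `(q₀·q_s)² ≥ n²Fγ/24`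
  set κ : ℝ := ∑ i, (K0 i : ℝ) * m i with hκ
  set κθ : ℝ := ∑ i, q0 i * qs i with hκθ
  have hcov' : γ / 6 * F ≤ κ ^ 2 := by rw [← hFeq]; exact hcov
  have hA : (n:ℝ) ^ 2 * (γ / 6 * F) ≤ ((n:ℝ) * κ) ^ 2 := by rw [mul_pow]; exact mul_le_mul_of_nonneg_left hcov' (sq_nonneg _)
  have herr : (κθ - (n:ℝ) * κ) ^ 2 ≤ 61 * θ ^ 2 * F * (3 * (n:ℝ) ^ 2) := by
    have h := dot_twist_sub_sq_le hθ hθ6 hG K0 Ks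
    rw [hdotK] at h
    exact h.trans (mul_le_mul_of_nonneg_left hKs3 (by positivity))
  -- `4·err² ≤ (nκ)²` from `4392 θ² ≤ γ` (`4·183 = 732 ≤ 4392/6`)
  have herr4 : 4 * (κθ - (n:ℝ) * κ) ^ 2 ≤ ((n:ℝ) * κ) ^ 2 := by
    have h1 : 4 * (61 * θ ^ 2 * F * (3 * (n:ℝ) ^ 2)) = 732 * θ ^ 2 * ((n:ℝ) ^ 2 * F) := by ring
    have h2 : 732 * θ ^ 2 ≤ γ / 6 := by linarith
    have h3 : 732 * θ ^ 2 * ((n:ℝ) ^ 2 * F) ≤ γ / 6 * ((n:ℝ) ^ 2 * F) := mul_le_mul_of_nonneg_right h2 (by positivity)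
    have h4 : γ / 6 * ((n:ℝ) ^ 2 * F) = (n:ℝ) ^ 2 * (γ / 6 * F) := by ring
    linarith [mul_le_mul_of_nonneg_left herr (by norm_num : (0:ℝ) ≤ 4)]
  have hκθsq : ((n:ℝ) * κ) ^ 2 / 4 ≤ κθ ^ 2 := by
    -- `|a| ≥ 2|e|` ⇒ `(a + e)² ≥ a²/4` with `a = nκ`, `e = κθ − nκ`
    have key : ∀ a e : ℝ, 4 * e ^ 2 ≤ a ^ 2 → a ^ 2 / 4 ≤ (a + e) ^ 2 := by
      intro a e h
      have ha : 2 * |e| ≤ |a| := by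
        have hsq : (2 * |e|) ^ 2 ≤ |a| ^ 2 := by rw [mul_pow, sq_abs, sq_abs]; linarith
        have h' := abs_le_of_sq_le_sq'' hsq (abs_nonneg a)
        rwa [abs_of_nonneg (by positivity : (0:ℝ) ≤ 2 * |e|)] at h'
      have h2 : |a| - |e| ≤ |a + e| := by
        have := abs_sub_abs_le_abs_sub a (-e)
        rwa [abs_neg, sub_neg_eq_add] at this
      have h1 : |a| / 2 ≤ |a + e| := by linarith
      have h0 : 0 ≤ |a| / 2 := by positivity
      have h3 := pow_le_pow_left₀ h0 h1 2
      rw [sq_abs, div_pow, sq_abs] at h3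
      linarith
    have := key ((n:ℝ) * κ) (κθ - (n:ℝ) * κ) herr4
    rwa [show (n:ℝ) * κ + (κθ - (n:ℝ) * κ) = κθ by ring] at this
  -- (3) the scalar lower bound of the twisted coefficient, then the explicit numbers
  have hlow := drain_floor_coeffR_lower hq0ne qs
  refine le_trans ?_ hlow
  have hS0 : 0 ≤ ∑ a, qs a ^ 2 := Finset.sum_nonneg fun a _ => sq_nonneg _
  -- denominator: `|q₀|²(√|q_s|² + √|q₀|²)² ≤ (1+3θ)²F · (1+3θ)²(n‖m‖ + ‖K₀‖)² ≤ (1+3θ)⁴ F · 5n²`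
  set a0 : ℝ := ‖Torus.latticeVec K0‖ with ha0
  set b0 : ℝ := ‖Torus.latticeVec m‖ with hb0
  have ha0F : a0 = Real.sqrt F := by rw [← hFeq, Real.sqrt_sq (norm_nonneg _)]
  have hsqs : Real.sqrt (∑ a, qs a ^ 2) ≤ (1 + 3 * θ) * ((n:ℝ) * b0) := by
    have h1 : ∑ a, qs a ^ 2 ≤ ((1 + 3 * θ) * ((n:ℝ) * b0)) ^ 2 := by
      rw [mul_pow, mul_pow, hb0, Literature.Analysis.FunctionSpaces.Torus.norm_latticeVec_sq, ← hKsN]; exact hqshi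
    calc Real.sqrt (∑ a, qs a ^ 2) ≤ Real.sqrt (((1 + 3 * θ) * ((n:ℝ) * b0)) ^ 2) := Real.sqrt_le_sqrt h1
      _ = (1 + 3 * θ) * ((n:ℝ) * b0) := Real.sqrt_sq (by positivity)
  have hsq0 : Real.sqrt (∑ a, q0 a ^ 2) ≤ (1 + 3 * θ) * a0 := by
    have h1 : ∑ a, q0 a ^ 2 ≤ ((1 + 3 * θ) * a0) ^ 2 := by rw [mul_pow, hFeq]; exact hq0hi
    calc Real.sqrt (∑ a, q0 a ^ 2) ≤ Real.sqrt (((1 + 3 * θ) * a0) ^ 2) := Real.sqrt_le_sqrt h1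
      _ = (1 + 3 * θ) * a0 := Real.sqrt_sq (by positivity)
  have hden5 := chain_denominator_le (K0 := K0) h2 hm3
  rw [← ha0, ← hb0] at hden5
  have hdenom : (∑ a, q0 a ^ 2) * (Real.sqrt (∑ a, qs a ^ 2) + Real.sqrt (∑ a, q0 a ^ 2)) ^ 2
      ≤ ((1 + 3 * θ) ^ 2 * F) * ((1 + 3 * θ) ^ 2 * (5 * (n:ℝ) ^ 2)) := by
    have hsum : Real.sqrt (∑ a, qs a ^ 2) + Real.sqrt (∑ a, q0 a ^ 2) ≤ (1 + 3 * θ) * ((n:ℝ) * b0 + a0) := by linarith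
    have hsum2 : (Real.sqrt (∑ a, qs a ^ 2) + Real.sqrt (∑ a, q0 a ^ 2)) ^ 2 ≤ ((1 + 3 * θ) * ((n:ℝ) * b0 + a0)) ^ 2 :=
      pow_le_pow_left₀ (by positivity) hsum 2
    have hsum3 : ((1 + 3 * θ) * ((n:ℝ) * b0 + a0)) ^ 2 ≤ (1 + 3 * θ) ^ 2 * (5 * (n:ℝ) ^ 2) := by
      rw [mul_pow]; exact mul_le_mul_of_nonneg_left hden5 (sq_nonneg _)
    exact mul_le_mul hq0hi (hsum2.trans hsum3) (by positivity) (by positivity)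
  have hdenpos : 0 < (∑ a, q0 a ^ 2) * (Real.sqrt (∑ a, qs a ^ 2) + Real.sqrt (∑ a, q0 a ^ 2)) ^ 2 := by
    have : 0 < Real.sqrt (∑ a, q0 a ^ 2) := Real.sqrt_pos.2 hq0pos
    positivity
  rw [le_div_iff₀ hdenpos]
  -- `γ/304 · den ≤ γ/304 · (1+3θ)⁴ 5 n² F ≤ γ/304 · (81/16) · 5 n² F ≤ 2 (nκ)²/4 ≤ 2 κθ²`
  have h81 : (1 + 3 * θ) ^ 2 * ((1 + 3 * θ) ^ 2) ≤ 81 / 16 := by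
    have h32 : 1 + 3 * θ ≤ 3 / 2 := by linarith
    have h94 : (1 + 3 * θ) ^ 2 ≤ (3 / 2) ^ 2 := pow_le_pow_left₀ (by linarith) h32 2
    calc (1 + 3 * θ) ^ 2 * ((1 + 3 * θ) ^ 2) ≤ (3 / 2) ^ 2 * (3 / 2) ^ 2 := mul_le_mul h94 h94 (sq_nonneg _) (by norm_num)
      _ = 81 / 16 := by norm_num
  have hX0 : 0 ≤ 5 * ((n:ℝ) ^ 2 * F) := by positivity
  have hγ0 : 0 ≤ γ / 304 := by positivity
  have step3 : (1 + 3 * θ) ^ 2 * ((1 + 3 * θ) ^ 2) * (5 * ((n:ℝ) ^ 2 * F)) ≤ 81 / 16 * (5 * ((n:ℝ) ^ 2 * F)) :=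
    mul_le_mul_of_nonneg_right h81 hX0
  have step4 : γ / 304 * ((1 + 3 * θ) ^ 2 * ((1 + 3 * θ) ^ 2) * (5 * ((n:ℝ) ^ 2 * F))) ≤ γ / 304 * (81 / 16 * (5 * ((n:ℝ) ^ 2 * F))) :=
    mul_le_mul_of_nonneg_left step3 hγ0
  have hA' : (n:ℝ) ^ 2 * F * γ ≤ 6 * ((n:ℝ) * κ) ^ 2 := by
    have e : (n:ℝ) ^ 2 * F * γ = 6 * ((n:ℝ) ^ 2 * (γ / 6 * F)) := by ring
    rw [e]; linarith [hA]
  calc γ / 304 * ((∑ a, q0 a ^ 2) * (Real.sqrt (∑ a, qs a ^ 2) + Real.sqrt (∑ a, q0 a ^ 2)) ^ 2)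
      ≤ γ / 304 * (((1 + 3 * θ) ^ 2 * F) * ((1 + 3 * θ) ^ 2 * (5 * (n:ℝ) ^ 2))) := mul_le_mul_of_nonneg_left hdenom hγ0
    _ = γ / 304 * ((1 + 3 * θ) ^ 2 * ((1 + 3 * θ) ^ 2) * (5 * ((n:ℝ) ^ 2 * F))) := by ring
    _ ≤ γ / 304 * (81 / 16 * (5 * ((n:ℝ) ^ 2 * F))) := step4
    _ = (405 / 4864) * ((n:ℝ) ^ 2 * F * γ) := by ring
    _ ≤ (405 / 4864) * (6 * ((n:ℝ) * κ) ^ 2) := mul_le_mul_of_nonneg_left hA' (by norm_num)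
    _ ≤ 2 * (((n:ℝ) * κ) ^ 2 / 4) := by linarith [sq_nonneg ((n:ℝ) * κ)]
    _ ≤ 2 * κθ ^ 2 := by linarith [hκθsq]

/-! ## §4 The drain floor in the twisted chain's index shapes -/

/-- **`hqw` of `slot_stepR` for the twisted chain**: for `z ⊥ G₀ᵀ(K₀ + 0·K_s)`,
`q_θ‖z‖² ≤ ‖P_{G₀ᵀ(K₀+1·K_s)} z‖² + ‖P_{G₀ᵀ(K₀+(−1)·K_s)} z‖²` with the explicit `q_θ` of `W7Slot.drain_floor_pairR`. [cite: BedrossianCotiZelati2017, §2 (hypocoercivity functional)] -/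
theorem hqw_chainR (G₀ : Matrix (Fin 3) (Fin 3) ℝ) (K0 Ks : Fin 3 → ℤ) (z : EuclideanSpace ℂ (Fin 3)) (hz : rdot (twistFreq G₀ (K0 + (0:ℤ) • Ks)) z = 0) :
    (2 - ((∑ a, twistFreq G₀ Ks a ^ 2) - (∑ i, twistFreq G₀ K0 i * twistFreq G₀ Ks i) ^ 2 / ∑ a, twistFreq G₀ K0 a ^ 2)
        * (1 / (∑ a, (twistFreq G₀ K0 + twistFreq G₀ Ks) a ^ 2) + 1 / (∑ a, (twistFreq G₀ K0 - twistFreq G₀ Ks) a ^ 2))) * ‖z‖ ^ 2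
      ≤ ‖transversalProjR (twistFreq G₀ (K0 + (1:ℤ) • Ks)) z‖ ^ 2 + ‖transversalProjR (twistFreq G₀ (K0 + (-1:ℤ) • Ks)) z‖ ^ 2 := by
  rw [zero_smul, add_zero] at hz
  rw [one_smul, neg_one_smul, ← sub_eq_add_neg, twistFreq_add, twistFreq_sub]
  exact drain_floor_pairR (twistFreq G₀ K0) (twistFreq G₀ Ks) hz

end Summit.AnomalousDissipation.AnomalousDissipation.Theorems.SolenoidalFractalHomogenisation.LagrangianStep.W7Cell
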